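import Mathlib
import Summits.BirchSwinnertonDyer.BirchSwinnertonDyer.Theorems.ManinLocalTwoThreeFourPRootNumberMinusOne
import HarnessLib

/-!
# Odd modular degree at level `4p` pins the Atkin–Lehner signs: `w_p f = f`, `w_4 f = −f`, `w_{4p} f = −f`

Summit `BirchSwinnertonDyer`, sub-problem `BirchSwinnertonDyer`, route `ManinLocalTwoThree`; width seat `bsd-line-manin23-p2`
(gen 9), `--supports` the crux C2 `ManinOddAtFour` (stmt-BirchSwinnertonDyer-22967).  E-blind, per datum: at `N = 4p` (`p` an
odd prime) the seat's `fourP_cusps_of_atkinLehner_p_eq_neg` (p660308: `w_p f_D = −f_D ⟹ 2 ∣ deg φ_D`) and the tree's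
`atkinLehnerInvolution_four_eq_neg` (`w_4 f = −f` for every newform at level `4·odd`) leave exactly one sign pattern for an
ODD-degree parametrisation: `w_p f_D = +f_D`, `w_4 f_D = −f_D`, hence Fricke sign `w_{4p} f_D = −f_D` (= root number `+1`).

PROVED here (no `sorry`): `frickeInvolution_eq_neg_of_atkinLehnerInvolutionAt_p_eq_self` (form level),
**`atkinLehnerInvolutionAt_p_eq_self_of_odd_deg`**, `atkinLehnerEigenvalueAt_p_eq_one_of_odd_deg`,
`atkinLehnerInvolutionAt_four_eq_neg_of_datum`, **`frickeInvolution_eq_neg_of_odd_deg`**.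
BSD is not proved by this; Manin's conjecture is not proved by this.
-/

set_option autoImplicit false
set_option linter.dupNamespace false

noncomputable section

open scoped MatrixGroups ModularForm
open CongruenceSubgroup
open Literature.NumberTheory.EllipticCurves Literature.NumberTheory.EllipticCurves.ModularForms

namespace Summit.BirchSwinnertonDyer.BirchSwinnertonDyer.Theorems.ManinLocalTwoThree

/-- **`N = 4p`, `w_p f = f` ⟹ `w_N f = −f`** for a newform `f` (`w_N`-eigenvalue `= λ_2·λ_p = (−1)·(+1)`). -/
theorem frickeInvolution_eq_neg_of_atkinLehnerInvolutionAt_p_eq_self {p : ℕ} [NeZero (4 * p)] (hp : p.Prime) (hp2 : p ≠ 2)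
    {f : CuspForm (Gamma0 (4 * p)) 2} (hf : IsNewform0 f) (hε : atkinLehnerInvolutionAt (4 * p) 2 p f = f) :
    frickeInvolution (4 * p) 2 f = -f := by
  have hlamp : atkinLehnerEigenvalueAt f p = 1 :=
    atkinLehnerEigenvalueAt_eq_of_eq_smul hf.ne_zero (by rw [hε, one_smul])
  have hprod := frickeEigenvalue_eq_prod_atkinLehnerEigenvalueAt_of_forall hf.ne_zero fun q hq =>
    (IsNewform0.exists_atkinLehnerInvolutionAt_eq_smul_holds hf (Nat.prime_of_mem_primeFactors hq)
      (Nat.dvd_of_mem_primeFactors hq)).imp fun _ h => h.2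
  have hpf : (4 * p).primeFactors = {2, p} := by
    rw [show 4 * p = 2 ^ 2 * p by norm_num, Nat.primeFactors_mul (by norm_num) hp.ne_zero,
      Nat.primeFactors_prime_pow (by norm_num) Nat.prime_two, hp.primeFactors]
    rfl
  rw [hpf, Finset.prod_pair (Ne.symm hp2), atkinLehnerEigenvalueAt_two_eq_neg_one_four_mul hp hp2 hf, hlamp] at hprod
  rw [IsNewform0.frickeInvolution_eq_smul_holds hf, hprod]
  norm_num

/-- **Odd modular degree at `N = 4p` ⟹ `w_p f_D = f_D`** (every curve, every datum; `p` an odd prime): the newform is a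
`w_p`-eigenvector with sign `±1`, and the sign `−1` forces an even degree (`fourP_cusps_of_atkinLehner_p_eq_neg`). -/
theorem atkinLehnerInvolutionAt_p_eq_self_of_odd_deg {p : ℕ} [NeZero (4 * p)] (hp : p.Prime) (hp2 : p ≠ 2)
    {W : WeierstrassCurve ℚ} [W.IsElliptic] (D : ModularParametrizationData W (4 * p)) (hodd : Odd D.deg) :
    atkinLehnerInvolutionAt (4 * p) 2 p D.f = D.f := by
  obtain ⟨ε, hε, hw⟩ :=
    IsNewform0.exists_atkinLehnerInvolutionAt_eq_smul_holds D.isNewformOf.1 hp (Dvd.intro_left 4 rfl)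
  rcases hε with rfl | rfl
  · rw [hw, one_smul]
  · exfalso
    rw [neg_one_smul] at hw
    exact Nat.not_even_iff_odd.mpr hodd (even_iff_two_dvd.mpr (fourP_cusps_of_atkinLehner_p_eq_neg hp hp2 D hw).2.2.2)

/-- **Odd modular degree at `N = 4p` ⟹ `λ_p(f_D) = +1`.** -/
theorem atkinLehnerEigenvalueAt_p_eq_one_of_odd_deg {p : ℕ} [NeZero (4 * p)] (hp : p.Prime) (hp2 : p ≠ 2)
    {W : WeierstrassCurve ℚ} [W.IsElliptic] (D : ModularParametrizationData W (4 * p)) (hodd : Odd D.deg) :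
    atkinLehnerEigenvalueAt D.f p = 1 :=
  atkinLehnerEigenvalueAt_eq_of_eq_smul D.isNewformOf.1.ne_zero
    (by rw [atkinLehnerInvolutionAt_p_eq_self_of_odd_deg hp hp2 D hodd, one_smul])

/-- **`w_4 f_D = −f_D` at `N = 4p`** for every datum (the tree's `atkinLehnerInvolution_four_eq_neg`, restated per datum). -/
theorem atkinLehnerInvolutionAt_two_eq_neg_of_datum {p : ℕ} [NeZero (4 * p)] (hp : p.Prime) (hp2 : p ≠ 2)
    {W : WeierstrassCurve ℚ} [W.IsElliptic] (D : ModularParametrizationData W (4 * p)) :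
    atkinLehnerInvolutionAt (4 * p) 2 2 D.f = -D.f := by
  rw [atkinLehnerInvolutionAt_eq (N := 4 * p) (k := 2) (factorization_two_four_mul hp hp2),
    atkinLehnerInvolution_four_eq_neg (hp.odd_of_ne_two hp2) D.f D.isNewformOf.1]

/-- **Odd modular degree at `N = 4p` ⟹ Fricke sign `−1`: `w_{4p} f_D = −f_D`** (equivalently root number `+1`,
cf. `rootNumber_eq_one_of_odd_modularDegree'`), for every curve and every datum. -/
theorem frickeInvolution_eq_neg_of_odd_deg {p : ℕ} [NeZero (4 * p)] (hp : p.Prime) (hp2 : p ≠ 2)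
    {W : WeierstrassCurve ℚ} [W.IsElliptic] (D : ModularParametrizationData W (4 * p)) (hodd : Odd D.deg) :
    frickeInvolution (4 * p) 2 D.f = -D.f :=
  frickeInvolution_eq_neg_of_atkinLehnerInvolutionAt_p_eq_self hp hp2 D.isNewformOf.1
    (atkinLehnerInvolutionAt_p_eq_self_of_odd_deg hp hp2 D hodd)

end Summit.BirchSwinnertonDyer.BirchSwinnertonDyer.Theorems.ManinLocalTwoThree

end
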